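import Summits.ABC.IUTFork.LDHSplitPlaceArithmetic
import HarnessLib

/-!
# The fork at [IUTchIII] Corollary 3.12, L-DH level, reading (U): GENUINE `λ`-line points of degree `2` with ONE
# split multiplicative prime of UNBOUNDED depth — the non-vacuity / unboundedness half of the Szpiro-type
# certificate for the (U)-line's CONE binder `hvol` / `hreg` (abc-iut cell, R2 S-chain team, seat abc-iut-s2-p3)

Record-only PROOF file (D-0012) of the abc-iut cell; TAKES NO SIDE on [IUTchIII] Cor. 3.12 or [IUTchIV] Thm. 1.10.
S. Mochizuki, *IUT IV* [Mochizuki2012], Thm. 1.10 proof Step (v), kurims pp. 27–28 ("we may assume that `i†` is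
`j`"; "after passing to weighted averages, the operation of symmetrizing with respect to the choice of `i† ∈ I` does
not affect the computation of the upper bound"), Cor. 2.2 (ii) proof pp. 45–46 ((P2), (P5), (P6); `𝕍^bad_mod` = the
places of `F_mod` not dividing `2l` of bad multiplicative reduction); S. Mochizuki, *Arithmetic elliptic curves in
general position* [MochizukiGenEll2010], Def. 1.5 (i) p. 8 (minimal field of definition), Thm. 2.1 (ii) p. 11
(`U_X = ℙ¹ ∖ {0,1,∞}`); Dupuy–Hilado [DupuyHilado2025] §3.3 (`P_q`, `ord_v(q_v) = −ord_v(j_E)`), §3.6 (weights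
`Pr(v) = n_v/[F:ℚ]`), §4.7 ((Ind1) = permutations of the tensor factors).

WHY. The (U)-line of crux `ThetaPartII` (stmt-ABC-19678) closes `ABC` from [IUTchIII] Cor. 3.12 (reading (U)) and the
CONE binder `hvol : ∀ P ∈ UP, ∀ l prime ≥ 5, AdmitsCore → CondP2 → CondP5 → CondP6 → Cor22.HullVolumeAtDatum P l B_III(P,l)`
of `Conditional.abc_of_S_v3` (v4: `hreg`, the same at non-slot-constant data). abc-iut-S8 proved that
`HullVolumeAtDatum P l δ` forces `slotResidue(T) ≤ δ` at every genuine datum, abc-iut-S7 that it forces, place by place,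
`Pr(v)·Pr(w)·(l(l+1)/12)·((−ord_v j)/(2l))·ln N(v)/n_v ≤ δ` for a bad/non-bad pair `v, w` of places of `F_mod` over one
prime. A `∀`-statement over points is only as strong as the points that satisfy its antecedents: THIS FILE supplies,
in the kernel, GENUINE points of the `λ`-line (not synthetic Θ-volume inputs) at which those antecedents hold and the
left-hand side of S7's pair inequality is UNBOUNDED while the field (hence `log-diff`) stays fixed:

* toolkit (`LDHSplitPlaceArithmetic`): `SplitDepth.exists_integer` (CRT: `y ∈ v₀^M`, `y ≡ 2 (mod w)` at two distinct
  places `v₀ ≠ w` over `p`), `ord_ratCast_pos_iff` / `ord_ratCast_neg_iff` (a RATIONAL number has a zero (pole) at one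
  place over `p` iff at every place over `p`, so a split zero/pole certifies irrationality — of `y` and of `j(y)`);
* **`SplitDepth.exists_point`** — for every number field `F` of degree `2`, every odd prime `p` under two distinct
  places `v₀ ≠ w` of `F` and every `M ≥ 1` there is `λ ∈ F` with: `P := (F, λ) ∈ UP` (`λ ∈ U_X`, `F = ℚ(λ)` minimal),
  `Cor22.dmod P = 2` (`F_mod = ℚ(j(λ)) = F`), `Cor22.AdmitsCore P` (the four exceptional `j` are rational),
  `Cor22.CondP5 P l` for every prime `l ≠ p` (the place `v₀ ∤ 2l` is a pole of `j(λ)`), and the SPLIT PAIR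
  `ord_{v₀} j(λ) ≤ −2M`, `0 ≤ ord_w j(λ)` with `n_{v₀} = n_w = 1`, `Pr(v₀) = Pr(w) = 1/2`, `ln N(v₀) = ln p` — so
  S7's left-hand side at `(v₀, w)` is `≥ (1/4)·(l(l+1)/12)·(2M/(2l))·ln p = (l+1)·M·ln p/48`, linear in the depth `M`;
* **`SplitDepth.exists_point_cyclotomicField_three`** — the ABSOLUTE form over `F = ℚ(ζ₃)`, `p = 7` (two places by
  abc-iut-S7's `exists_two_placesOver_cyclotomicField_three`): for every `M ≥ 1` such a point exists.

READING (for the planners; nothing asserted about print). Together with abc-iut-S8/S7 (`LDHSlotResidue`,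
`LDHSlotResiduePointPair`) and the datum existence `ThetaPartII.stub_thetaData`, the CONE binder of the (U)-line asserts
at these points (given (P2), (P6) at `(P_M, l)`) the inequality `(l+1)·M·ln p/48 ≤ B_III(P_M, l)`, i.e. an EFFECTIVE
Szpiro/abc-type lower bound `log-cond(λ_M) ≥ M·ln p/(12·(1+24/l)) − C(l)` on the conductor of `λ_M(1−λ_M)` over a FIXED
quadratic field — linear in the depth, beyond every known unconditional bound, and violated only by an abc-violating
configuration. So at `d_mod = 2` the binder is NEITHER vacuous NOR bounded: this is the genuine-point half of the cell's
«Szpiro-type obstruction» certificate (VERDICT RISK ¶7); the composition with `hvol`/`hreg` is filed separately under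
`Conditional/`. HONEST SCOPE: classical arithmetic of the `λ`-line; no Θ-datum is constructed here; nothing asserts or
denies [IUTchIV] Thm. 1.10 or [IUTchIII] Cor. 3.12; typed ≠ proved; no side taken. PROOF-ONLY file: no definitions,
no `Prop` facts. [cite: Mochizuki2012, IUTchIV Thm. 1.10 Step (v) p. 27–28] [cite: Mochizuki2012, IUTchIV Cor. 2.2 (ii)
proof p. 45–46] [cite: MochizukiGenEll2010, Def 1.5 (i) p.8] [cite: DupuyHilado2025, §3.3, §3.6, §4.7]
[claim: Mochizuki2012, status: disputed] for every IUT quotation.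
-/

noncomputable section

open NumberField IsDedekindDomain Literature.IUT.LogVolume
open Literature.NumberTheory.DiophantineGeometry.GenEll
open scoped IntermediateField

namespace Summit.ABC.IUTFork

namespace SplitDepth

variable {F : Type} [Field F] [NumberField F] {p : ℕ} [hp : Fact p.Prime]

/-! ## The genuine points -/

/-- **GENUINE `λ`-LINE POINTS OF DEGREE `2` WITH ONE SPLIT MULTIPLICATIVE PRIME OF DEPTH `≥ M`.** For every number field
`F` with `[F:ℚ] = 2`, every odd prime `p` under two distinct places `v₀ ≠ w` of `F`, and every `M ≥ 1`, there is `λ ∈ F`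
such that the point `P = (F, λ)` satisfies: `P ∈ UP` (`λ ≠ 0, 1` and `ℚ(λ) = F`); `Cor22.dmod P = 2` (`F_mod = ℚ(j(λ))`
has degree `2`, indeed `ℚ(j(λ)) = F`); `Cor22.AdmitsCore P`; `Cor22.CondP5 P l` for every prime `l ≠ p`; the split pair at `p`:
`ord_{v₀} j(λ) ≤ −2M` (a pole of `j` — multiplicative reduction — of depth `≥ 2M` at `v₀`), `0 ≤ ord_w j(λ)` (no pole at
the OTHER place over `p`), `2 ∉ v₀` and `l ∉ v₀` for every prime `l ≠ p` (so `v₀ ∈ 𝕍^bad_mod` for (P5)'s choice at any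
`l ≠ p`); and the local data `n_{v₀} = n_w = 1`, `Pr(v₀) = Pr(w) = 1/2`, `ln N(v₀) = ln p`. Classical (CRT + valuations);
the depth `M` is free while the field — hence `log-diff(P)` — is fixed. [cite: Mochizuki2012, IUTchIV Cor. 2.2 (ii)
proof p. 45–46] [cite: MochizukiGenEll2010, Def 1.5 (i) p.8] [cite: DupuyHilado2025, §3.3, §3.6] -/
theorem exists_point (hF : Module.finrank ℚ F = 2) (hp2 : p ≠ 2) (v₀ w : placesOver F p) (hvw : w ≠ v₀)
    (M : ℕ) (hM : 1 ≤ M) :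
    ∃ x : F, NFPoint.mk F x ∈ UP ∧ Cor22.dmod (NFPoint.mk F x) = 2 ∧
      IntermediateField.adjoin ℚ ({Cor22.jInv x} : Set F) = ⊤ ∧ Cor22.AdmitsCore (NFPoint.mk F x) ∧
      (∀ l : ℕ, l.Prime → l ≠ p → Cor22.CondP5 (NFPoint.mk F x) l) ∧
      ord F v₀.1 (Cor22.jInv x) ≤ -(2 * M : ℤ) ∧ 0 ≤ ord F w.1 (Cor22.jInv x) ∧
      ((2 : ℕ) : 𝓞 F) ∉ v₀.1.asIdeal ∧ (∀ l : ℕ, l.Prime → l ≠ p → ((l : ℕ) : 𝓞 F) ∉ v₀.1.asIdeal) ∧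
      localDegree F v₀.1 = 1 ∧ localDegree F w.1 = 1 ∧ weight F v₀.1 = 1 / 2 ∧ weight F w.1 = 1 / 2 ∧
      logNorm F v₀.1 = Real.log p := by
  obtain ⟨y, hy, hy2⟩ := exists_integer v₀ w hvw M
  have hjv := ord_jInv_v_le v₀ w hp2 hM hy hy2
  have hjw := ord_jInv_w_nonneg v₀ w hp2 hM hy hy2
  have hxb := integer_not_mem_bot v₀ w hp2 hM hy hy2
  have hjb := jInv_not_mem_bot v₀ w hp2 hM hy hy2
  have hx0 : (y : F) ≠ 0 := fun h => hxb (h ▸ (⊥ : IntermediateField ℚ F).zero_mem)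
  have hx1 : (y : F) ≠ 1 := fun h => hxb (h ▸ (⊥ : IntermediateField ℚ F).one_mem)
  have h2 : ((2 : ℕ) : 𝓞 F) ∉ v₀.1.asIdeal := natCast_not_mem_of_prime_ne v₀ Nat.prime_two (Ne.symm hp2)
  have hl : ∀ l : ℕ, l.Prime → l ≠ p → ((l : ℕ) : 𝓞 F) ∉ v₀.1.asIdeal :=
    fun l hl hlp => natCast_not_mem_of_prime_ne v₀ hl hlp
  obtain ⟨hn1, hn2⟩ := localDegree_eq_one hF v₀ w hvw
  obtain ⟨hwt1, hlog⟩ := weight_eq_half_and_logNorm_eq hF v₀ w hvw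
  obtain ⟨hwt2, -⟩ := weight_eq_half_and_logNorm_eq hF w v₀ (Ne.symm hvw)
  refine ⟨(y : F), ⟨⟨hx0, hx1⟩, ?_⟩, ?_, adjoin_simple_eq_top_of_not_mem_bot hF hjb, ?_, ?_, hjv, hjw, h2, hl, hn1,
    hn2, hwt1, hwt2, hlog⟩
  · -- minimality: `ℚ(λ) = F`
    exact adjoin_simple_eq_top_of_not_mem_bot hF hxb
  · -- `d_mod = [ℚ(j(λ)):ℚ] = 2`
    show Module.finrank ℚ (IntermediateField.adjoin ℚ ({Cor22.jInv (y : F)} : Set F)) = 2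
    rw [adjoin_simple_eq_top_of_not_mem_bot hF hjb, IntermediateField.finrank_top', hF]
  · -- admits a core: the exceptional `j` are rational
    intro q _ hq
    exact hjb (hq ▸ (IntermediateField.mem_bot.mpr ⟨q, (eq_ratCast (algebraMap ℚ F) q)⟩))
  · -- (P5) at every prime `l ≠ p`
    intro l hlP hlp
    refine ⟨v₀.1, ?_, h2, hl l hlP hlp⟩
    show ord F v₀.1 (Cor22.jInv (y : F)) < 0
    omega

/-- **ABSOLUTE FORM over `ℚ(ζ₃)` at `p = 7`.** For every `M ≥ 1` there are two distinct places `v₀ ≠ w` of `ℚ(ζ₃)` over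
`7` (abc-iut-S7) and `λ ∈ ℚ(ζ₃)` with all the properties of `exists_point`: a GENUINE `λ`-line point of degree `2`, in
`UP`, with `d_mod = 2`, admitting a core, satisfying (P5) at every prime `l ≠ 7`, whose `j`-invariant has a pole of order
`≥ 2M` at `v₀` and none at `w`, `Pr(v₀) = Pr(w) = 1/2`, `ln N(v₀) = ln 7`. The family is unbounded in `M` over ONE field.
[cite: Mochizuki2012, IUTchIV Cor. 2.2 (ii) proof p. 45–46] [cite: MochizukiGenEll2010, Def 1.5 (i) p.8]
[cite: NeukirchANT1999, Ch. I §8, §10] -/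
theorem exists_point_cyclotomicField_three (M : ℕ) (hM : 1 ≤ M) :
    ∃ (v₀ w : placesOver (CyclotomicField 3 ℚ) 7) (x : CyclotomicField 3 ℚ), w ≠ v₀ ∧
      NFPoint.mk (CyclotomicField 3 ℚ) x ∈ UP ∧ Cor22.dmod (NFPoint.mk (CyclotomicField 3 ℚ) x) = 2 ∧
      IntermediateField.adjoin ℚ ({Cor22.jInv x} : Set (CyclotomicField 3 ℚ)) = ⊤ ∧
      Cor22.AdmitsCore (NFPoint.mk (CyclotomicField 3 ℚ) x) ∧
      (∀ l : ℕ, l.Prime → l ≠ 7 → Cor22.CondP5 (NFPoint.mk (CyclotomicField 3 ℚ) x) l) ∧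
      ord (CyclotomicField 3 ℚ) v₀.1 (Cor22.jInv x) ≤ -(2 * M : ℤ) ∧
      0 ≤ ord (CyclotomicField 3 ℚ) w.1 (Cor22.jInv x) ∧
      ((2 : ℕ) : 𝓞 (CyclotomicField 3 ℚ)) ∉ v₀.1.asIdeal ∧
      (∀ l : ℕ, l.Prime → l ≠ 7 → ((l : ℕ) : 𝓞 (CyclotomicField 3 ℚ)) ∉ v₀.1.asIdeal) ∧
      localDegree (CyclotomicField 3 ℚ) v₀.1 = 1 ∧ localDegree (CyclotomicField 3 ℚ) w.1 = 1 ∧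
      weight (CyclotomicField 3 ℚ) v₀.1 = 1 / 2 ∧ weight (CyclotomicField 3 ℚ) w.1 = 1 / 2 ∧
      logNorm (CyclotomicField 3 ℚ) v₀.1 = Real.log 7 := by
  haveI h7 : Fact (Nat.Prime 7) := ⟨by norm_num⟩
  haveI hK : IsCyclotomicExtension {3} ℚ (CyclotomicField 3 ℚ) := CyclotomicField.isCyclotomicExtension 3 ℚ
  have hF : Module.finrank ℚ (CyclotomicField 3 ℚ) = 2 := by
    rw [IsCyclotomicExtension.Rat.finrank 3 (CyclotomicField 3 ℚ)]; decide
  obtain ⟨v₀, w, hvw⟩ := exists_two_placesOver_cyclotomicField_three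
  obtain ⟨x, hx⟩ := exists_point hF (by norm_num) v₀ w hvw M hM
  refine ⟨v₀, w, x, hvw, ?_⟩
  have h7 : Real.log ((7 : ℕ) : ℝ) = Real.log 7 := by norm_num
  rw [h7] at hx
  exact hx

end SplitDepth

end Summit.ABC.IUTFork

end
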